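import Summits.NavierStokesRegularity.NavierStokesRegularity.Theorems.FrozenSignCascadeBoundedEnvelopeContinuationMorreyTypeIBound
import Literature.Analysis.FluidPDE.LocalTypeIReverseTools
import HarnessLib

/-!
# Route FrozenSignCascade · crux `BoundedEnvelopeContinuation` — the small-Morrey regime, part 1:
# `C` and the mean-free `D` are uniformly SMALL on every past ball when the Morrey constant is small

Helper file for the crux item stmt-NavierStokesRegularity-10579 (`BoundedEnvelopeContinuation`,
conjunct (B) of route `FrozenSignCascade`), line `registered` (reshape r3); lands `--supports`
that item. The one open stub of the line is the Liouville statement (L_M) for bounded ancient mild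
solutions with the scale-invariant Morrey bound `∫_{B_r(y)} ‖v t‖² ≤ M r` at ALL radii; this file
and its sequel (`…LiouvilleMorreySmall.lean`) settle its SMALL-CONSTANT case `M ≤ M₀`.

**Theorem (`small_cknC_cknDOsc_of_morrey`, registered sub-goal `cknC_cknDOsc_small_of_morrey`).** For every `ε > 0` there is `M₀ > 0` such that
for every classical solution `(v, P)` of the unforced unit-viscosity Navier–Stokes system on
`(-∞,0) × ℝ³`, bounded by some `V`, whose slices obey `∫_{B_r(y)} ‖v t‖² ≤ M r` for all `t < 0`,
`y`, `r > 0` with `0 ≤ M ≤ M₀`, Albritton–Barker's scaled quantities satisfy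
`C(Q(z,r)) ≤ ε` and `D(Q(z,r)) ≤ ε` (mean-free `D = cknDOsc`) on EVERY past ball (`z.1 ≤ 0`,
any radius).

**Proof.** Let `S = sup C` over all past balls; `S < ∞` by the bootstrap of lead c2
(`exists_abScaledSum_le_of_morrey`, Albritton–Barker 2019, Lemma 2.6). The landed per-ball
inequalities `A ≤ M` (`cknAEss_le_of_morrey`), `D(2r) ≤ 9K₁ C(6r) + K₂ M^{3/2}`
(`cknDOsc_le_of_morrey`), `A(r) + E(r) ≤ c₁C(2r)^{2/3} + c₂C(2r) + c₃D(2r)^{2/3}C(2r)^{1/3}`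
(`localEnergy_le`) and the multiplicative inequality `C ≤ C₀ A^{3/4}(A + E)^{3/4}`
(`Seregin2020.exists_cknC_le_finer`) give, for `M ≤ 1`,
`S ≤ C₀ M^{3/4} (κ₀ M + κ₁ S + c₁ S^{2/3})^{3/4}` — a HOMOGENEOUS inequality with the small
prefactor `C₀ M^{3/4}`. If `S ≤ M` we are done; if `M < S ≤ 1` the bracket is `≤ κ S^{2/3}`, so
`S^{1/2} ≤ C₀ κ^{3/4} M^{3/4}` and `S ≤ C₀² κ^{3/2} M`; and `S > 1` is impossible once
`C₀⁴ κ³ M₀ < 1` (the bracket is `≤ κ S`, so `S = (S^{1/4})⁴ ≤ C₀⁴κ³M³ < 1`). Hence `S ≤ Λ M`,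
`Λ = 1 + C₀²κ^{3/2}`, and `D ≤ (9K₁Λ + K₂) M`. This is the scale-invariant form of the
ε-regularity criterion in terms of `A` alone (Gustafson–Kang–Tsai 2007, Thm 1.1 with
`(p, q) = (2, ∞)`; Seregin 2007), in the global setting of the whole past where the smallness of
`A` at all scales replaces the limit `r → 0`.

## References

* D. Albritton, T. Barker, J. Math. Fluid Mech. 21 (2019) = arXiv:1811.00502, Lemma 2.6 and §3.
  [AlbrittonBarker2019]
* S. Gustafson, K. Kang, T.-P. Tsai, Comm. Math. Phys. 273 (2007) 161–176, Thm 1.1.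
  [GustafsonKangTsai2007]
* G. Seregin, J. Math. Sci. 143 (2007) = arXiv:math/0607537, §2, Lemma 2.1. [Seregin2006]
-/

noncomputable section

set_option linter.dupNamespace false -- nested layout Summit.<S>.<Sub>, Sub = S (D-0017)
-- nested operator types `(EuclideanSpace ℝ (Fin 3)) →L[ℝ] … →L[ℝ] ℝ` (pressure kernels), as in part 1/2
set_option maxSynthPendingDepth 3

open Set MeasureTheory Filter Topology Metric Function
open scoped ENNReal NNReal
open Literature.Analysis Literature.Analysis.FluidPDE
open Summit.NavierStokesRegularity.NavierStokesRegularity.Theorems.SingularProfile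

namespace Summit.NavierStokesRegularity.NavierStokesRegularity.Theorems.BoundedEnvelope

/-! ### Elementary `ℝ≥0∞` power facts -/

/-- `x = x^{1/4} · x^{3/4}` in `ℝ≥0∞`. [folklore] -/
theorem rpow_quarter_mul_rpow_three_quarters (x : ℝ≥0∞) :
    x ^ (1 / 4 : ℝ) * x ^ (3 / 4 : ℝ) = x := by
  rw [← ENNReal.rpow_add_of_nonneg _ _ (by norm_num) (by norm_num)]
  norm_num

/-- `(x^{1/4})⁴ = x` in `ℝ≥0∞`. [folklore] -/
theorem rpow_quarter_pow_four (x : ℝ≥0∞) : (x ^ (1 / 4 : ℝ)) ^ 4 = x := by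
  rw [← ENNReal.rpow_natCast, ← ENNReal.rpow_mul]
  norm_num

/-- `(x^{2/3})^{3/4} = x^{1/2}` in `ℝ≥0∞`. [folklore] -/
theorem rpow_two_thirds_rpow_three_quarters (x : ℝ≥0∞) :
    (x ^ (2 / 3 : ℝ)) ^ (3 / 4 : ℝ) = x ^ (1 / 2 : ℝ) := by
  rw [← ENNReal.rpow_mul]
  norm_num

/-- For `x ≤ 1`: `x ≤ x^{2/3}`. [folklore] -/
theorem le_rpow_two_thirds_of_le_one {x : ℝ≥0∞} (hx : x ≤ 1) : x ≤ x ^ (2 / 3 : ℝ) := by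
  conv_lhs => rw [← ENNReal.rpow_one x]
  exact ENNReal.rpow_le_rpow_of_exponent_ge hx (by norm_num)

/-- For `1 ≤ x`: `x^{2/3} ≤ x`. [folklore] -/
theorem rpow_two_thirds_le_of_one_le {x : ℝ≥0∞} (hx : 1 ≤ x) : x ^ (2 / 3 : ℝ) ≤ x := by
  conv_rhs => rw [← ENNReal.rpow_one x]
  exact ENNReal.rpow_le_rpow_of_exponent_le hx (by norm_num)

/-- For `x ≤ 1`: `x^{3/2} ≤ x`. [folklore] -/
theorem rpow_three_halves_le_of_le_one {x : ℝ≥0∞} (hx : x ≤ 1) : x ^ (3 / 2 : ℝ) ≤ x := by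
  conv_rhs => rw [← ENNReal.rpow_one x]
  exact ENNReal.rpow_le_rpow_of_exponent_ge hx (by norm_num)

/-! ### The smallness of `C` and `D` -/

/-- **Uniform smallness of `C` and of the mean-free `D` on every past ball in the small-Morrey
regime** (statement and proof in the module docstring): for every `ε > 0` there is `M₀ > 0` such
that every classical solution of the unforced unit-viscosity system on `(-∞,0)`, bounded, with
the Morrey bound `M ≤ M₀` at all radii, has `C(Q(z,r)) ≤ ε` and `D(Q(z,r)) ≤ ε` for all `r > 0`
and all centres with `z.1 ≤ 0`.
[cite: AlbrittonBarker2019, Lemma 2.6; GustafsonKangTsai2007, Thm 1.1] -/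
theorem small_cknC_cknDOsc_of_morrey :
    ∀ ε : ℝ≥0∞, 0 < ε → ∃ M₀ : ℝ, 0 < M₀ ∧
      ∀ (v : ℝ → EuclideanSpace ℝ (Fin 3) → EuclideanSpace ℝ (Fin 3))
        (P : ℝ → EuclideanSpace ℝ (Fin 3) → ℝ) (M V : ℝ), 0 ≤ M → M ≤ M₀ → 0 ≤ V →
        IsClassicalNSSolutionOn (Iio 0) 1 0 v P →
        (∀ t < 0, ∀ (y : EuclideanSpace ℝ (Fin 3)) (r : ℝ), 0 < r →
          ∫ x in ball y r, ‖v t x‖ ^ 2 ≤ M * r) →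
        (∀ t < 0, ∀ x, ‖v t x‖ ≤ V) →
        ∀ (r : ℝ), 0 < r → ∀ z : ℝ × EuclideanSpace ℝ (Fin 3), z.1 ≤ 0 →
          cknC r z v ≤ ε ∧ cknDOsc r z P ≤ ε := by
  intro ε hε
  -- ### the universal constants
  obtain ⟨c₁, c₂, c₃, HT⟩ := Seregin2020.localEnergyBound_top
  obtain ⟨C₀, hC₀⟩ := Seregin2020.exists_cknC_le_finer
  obtain ⟨K₁, K₂, hK₁t, hK₂t, hK⟩ := exists_slice_oscillation_bound
  set KD₁ : ℝ≥0∞ := K₁ * ENNReal.ofReal 3 ^ 2 with hKD₁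
  have hKD₁t : KD₁ ≠ ⊤ := ENNReal.mul_ne_top hK₁t (ENNReal.pow_ne_top ENNReal.ofReal_ne_top)
  -- `κ₀ = 1 + c₃ K₂`, `κ₁ = c₂ + c₃ (KD₁ + 1)`, `κ = κ₀ + κ₁ + c₁`
  set κ₀ : ℝ≥0∞ := 1 + c₃ * K₂ with hκ₀
  set κ₁ : ℝ≥0∞ := c₂ + c₃ * (KD₁ + 1) with hκ₁
  set κ : ℝ≥0∞ := κ₀ + κ₁ + c₁ with hκ
  have hκ₀t : κ₀ ≠ ⊤ := ENNReal.add_ne_top.2 ⟨ENNReal.one_ne_top, ENNReal.mul_ne_top ENNReal.coe_ne_top hK₂t⟩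
  have hκ₁t : κ₁ ≠ ⊤ := ENNReal.add_ne_top.2 ⟨ENNReal.coe_ne_top,
    ENNReal.mul_ne_top ENNReal.coe_ne_top (ENNReal.add_ne_top.2 ⟨hKD₁t, ENNReal.one_ne_top⟩)⟩
  have hκt : κ ≠ ⊤ := ENNReal.add_ne_top.2 ⟨ENNReal.add_ne_top.2 ⟨hκ₀t, hκ₁t⟩, ENNReal.coe_ne_top⟩
  have h1κ : 1 ≤ κ := by
    rw [hκ, hκ₀]
    calc (1 : ℝ≥0∞) ≤ 1 + c₃ * K₂ := le_self_add
      _ ≤ 1 + c₃ * K₂ + κ₁ + c₁ := by rw [add_assoc]; exact le_self_add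
  -- `B₁ = C₀ κ^{3/4}`, `Λ = 1 + B₁²`, `Γ = B₁⁴ + 1`
  set B₁ : ℝ≥0∞ := (C₀ : ℝ≥0∞) * κ ^ (3 / 4 : ℝ) with hB₁
  have hB₁t : B₁ ≠ ⊤ := ENNReal.mul_ne_top ENNReal.coe_ne_top
    (ENNReal.rpow_ne_top_of_nonneg (by norm_num) hκt)
  set Λ : ℝ≥0∞ := 1 + B₁ ^ 2 with hΛ
  have hΛt : Λ ≠ ⊤ := ENNReal.add_ne_top.2 ⟨ENNReal.one_ne_top, ENNReal.pow_ne_top hB₁t⟩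
  have hΛ0 : Λ ≠ 0 := by rw [hΛ]; exact ne_of_gt (lt_of_lt_of_le one_pos le_self_add)
  have h1Λ : 1 ≤ Λ := by rw [hΛ]; exact le_self_add
  have hBΛ : B₁ ^ 2 ≤ Λ := by rw [hΛ]; exact le_add_self
  set Γ : ℝ≥0∞ := B₁ ^ 4 + 1 with hΓ
  have hΓt : Γ ≠ ⊤ := ENNReal.add_ne_top.2 ⟨ENNReal.pow_ne_top hB₁t, ENNReal.one_ne_top⟩
  have hΓ0 : Γ ≠ 0 := by rw [hΓ]; exact ne_of_gt (lt_of_lt_of_le one_pos le_add_self)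
  have hBΓ : B₁ ^ 4 ≤ Γ := by rw [hΓ]; exact le_self_add
  -- the `D`-constant `Θ = KD₁ Λ + K₂ + 1`
  set Θ : ℝ≥0∞ := KD₁ * Λ + K₂ + 1 with hΘ
  have hΘt : Θ ≠ ⊤ := ENNReal.add_ne_top.2 ⟨ENNReal.add_ne_top.2 ⟨ENNReal.mul_ne_top hKD₁t hΛt, hK₂t⟩,
    ENNReal.one_ne_top⟩
  have hΘ0 : Θ ≠ 0 := by rw [hΘ]; exact ne_of_gt (lt_of_lt_of_le one_pos le_add_self)
  have hΘle : KD₁ * Λ + K₂ ≤ Θ := by rw [hΘ]; exact le_self_add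
  -- ### the threshold `τ = min (min 1 (2Γ)⁻¹) (min (ε/Λ) (ε/Θ))` and `M₀ = τ.toReal`
  set τ : ℝ≥0∞ := min (min 1 (2 * Γ)⁻¹) (min (ε / Λ) (ε / Θ)) with hτ
  have hτ1 : τ ≤ 1 := (min_le_left _ _).trans (min_le_left _ _)
  have hτΓ : τ ≤ (2 * Γ)⁻¹ := (min_le_left _ _).trans (min_le_right _ _)
  have hτΛ : τ ≤ ε / Λ := (min_le_right _ _).trans (min_le_left _ _)
  have hτΘ : τ ≤ ε / Θ := (min_le_right _ _).trans (min_le_right _ _)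
  have hτt : τ ≠ ⊤ := ne_top_of_le_ne_top ENNReal.one_ne_top hτ1
  have hτpos : 0 < τ := by
    rw [hτ]
    refine lt_min (lt_min one_pos ?_) (lt_min ?_ ?_)
    · exact ENNReal.inv_pos.2 (ENNReal.mul_ne_top ENNReal.ofNat_ne_top hΓt)
    · exact ENNReal.div_pos hε.ne' hΛt
    · exact ENNReal.div_pos hε.ne' hΘt
  refine ⟨τ.toReal, ENNReal.toReal_pos hτpos.ne' hτt, ?_⟩
  -- ### a solution in the small-Morrey regime
  intro v P M V hM hMM₀ hV hcl hMor hbd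
  set 𝔐 : ℝ≥0∞ := ENNReal.ofReal M with h𝔐
  have h𝔐t : 𝔐 ≠ ⊤ := ENNReal.ofReal_ne_top
  have h𝔐τ : 𝔐 ≤ τ := by
    rw [h𝔐, ← ENNReal.ofReal_toReal hτt]
    exact ENNReal.ofReal_le_ofReal hMM₀
  have h𝔐1 : 𝔐 ≤ 1 := h𝔐τ.trans hτ1
  set G : ℝ → EuclideanSpace ℝ (Fin 3) → EuclideanSpace ℝ (Fin 3) →L[ℝ] EuclideanSpace ℝ (Fin 3) :=
    fun t x => fderiv ℝ (v t) x with hG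
  have hcont : ∀ t < 0, Continuous (v t) := fun t ht => (hcl.contDiff_velocity ht).continuous
  have hQ : (((Literature.Analysis.FluidPDE.slab (EuclideanSpace ℝ (Fin 3)) (Set.Iio (0 : ℝ))
      isOpen_Iio) : TopologicalSpace.Opens (ℝ × EuclideanSpace ℝ (Fin 3))) :
      Set (ℝ × EuclideanSpace ℝ (Fin 3))) ⊆ Iio (0 : ℝ) ×ˢ univ := by
    rw [coe_slab]
  have hwg : HasWeakSpatialGradientOn (Literature.Analysis.FluidPDE.slab (EuclideanSpace ℝ (Fin 3))
      (Set.Iio (0 : ℝ)) isOpen_Iio) v G :=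
    hasWeakSpatialGradientOn_of_contDiffOn isOpen_Iio hQ (hcl.smooth_velocity.of_le (by norm_cast))
  -- ### `S = sup C` over the past balls is finite (lead c2's bootstrap)
  obtain ⟨K, hKt, hKb⟩ := exists_abScaledSum_le_of_morrey hM hV hcl hMor hbd
  set S : ℝ≥0∞ := ⨆ (r : ℝ) (_ : 0 < r) (z : ℝ × EuclideanSpace ℝ (Fin 3)) (_ : z.1 ≤ 0), cknC r z v
    with hS
  have hCS : ∀ r, 0 < r → ∀ z : ℝ × EuclideanSpace ℝ (Fin 3), z.1 ≤ 0 → cknC r z v ≤ S := by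
    intro r hr z hz
    rw [hS]
    exact le_iSup_of_le r (le_iSup_of_le hr (le_iSup_of_le z (le_iSup_of_le hz le_rfl)))
  have hSK : S ≤ K := by
    rw [hS]
    refine iSup_le fun r => iSup_le fun hr => iSup_le fun z => iSup_le fun hz => ?_
    exact cknC_le_abScaledSum.trans (hKb r hr z hz)
  have hSt : S ≠ ⊤ := ne_top_of_le_ne_top hKt hSK
  -- ### the per-ball inequalities
  -- `A ≤ 𝔐`
  have hA : ∀ r, 0 < r → ∀ z : ℝ × EuclideanSpace ℝ (Fin 3), z.1 ≤ 0 → cknAEss r z v ≤ 𝔐 :=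
    fun r hr z hz => cknAEss_le_of_morrey hcont hMor hr hz
  -- `D(2r) ≤ KD₁ S + K₂ 𝔐^{3/2}`
  have hD : ∀ r, 0 < r → ∀ z : ℝ × EuclideanSpace ℝ (Fin 3), z.1 ≤ 0 →
      cknDOsc (2 * r) z P ≤ KD₁ * S + K₂ * 𝔐 ^ (3 / 2 : ℝ) := by
    intro r hr z hz
    have h2r : 0 < 2 * r := by positivity
    have h := cknDOsc_le_of_morrey hK₁t hK hM hcl hMor hbd h2r hz
    calc cknDOsc (2 * r) z P
        ≤ K₁ * (ENNReal.ofReal 3 ^ 2 * cknC (3 * (2 * r)) z v) + K₂ * ENNReal.ofReal M ^ (3 / 2 : ℝ) := h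
      _ = KD₁ * cknC (3 * (2 * r)) z v + K₂ * 𝔐 ^ (3 / 2 : ℝ) := by rw [hKD₁, mul_assoc]
      _ ≤ KD₁ * S + K₂ * 𝔐 ^ (3 / 2 : ℝ) := by
          gcongr
          exact hCS _ (by positivity) z hz
  -- `E(r) ≤ c₁ S^{2/3} + κ₁ S + c₃ K₂ 𝔐^{3/2}`
  have hE : ∀ r, 0 < r → ∀ z : ℝ × EuclideanSpace ℝ (Fin 3), z.1 ≤ 0 →
      cknE r z G ≤ c₁ * S ^ (2 / 3 : ℝ) + κ₁ * S + c₃ * (K₂ * 𝔐 ^ (3 / 2 : ℝ)) := by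
    intro r hr z hz
    have h := localEnergy_le HT hcl hMor hbd hr hz
    have h2r : 0 < 2 * r := by positivity
    have hC2 : cknC (2 * r) z v ≤ S := hCS _ h2r z hz
    have hY : (KD₁ * S + K₂ * 𝔐 ^ (3 / 2 : ℝ)) ^ (2 / 3 : ℝ) * S ^ (1 / 3 : ℝ) ≤
        (KD₁ * S + K₂ * 𝔐 ^ (3 / 2 : ℝ)) + S := by
      have := Seregin2020.rpow_two_thirds_mul_rpow_one_third_le (KD₁ * S + K₂ * 𝔐 ^ (3 / 2 : ℝ)) S
        one_ne_zero ENNReal.one_ne_top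
      simpa using this
    calc cknE r z G ≤ cknAEss r z v + cknE r z G := le_add_self
      _ ≤ c₁ * cknC (2 * r) z v ^ (2 / 3 : ℝ) + c₂ * cknC (2 * r) z v +
            c₃ * (cknDOsc (2 * r) z P ^ (2 / 3 : ℝ) * cknC (2 * r) z v ^ (1 / 3 : ℝ)) := h
      _ ≤ c₁ * S ^ (2 / 3 : ℝ) + c₂ * S +
            c₃ * ((KD₁ * S + K₂ * 𝔐 ^ (3 / 2 : ℝ)) ^ (2 / 3 : ℝ) * S ^ (1 / 3 : ℝ)) := by
          gcongr
          exact hD r hr z hz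
      _ ≤ c₁ * S ^ (2 / 3 : ℝ) + c₂ * S + c₃ * ((KD₁ * S + K₂ * 𝔐 ^ (3 / 2 : ℝ)) + S) := by
          gcongr
      _ = c₁ * S ^ (2 / 3 : ℝ) + κ₁ * S + c₃ * (K₂ * 𝔐 ^ (3 / 2 : ℝ)) := by rw [hκ₁]; ring
  -- ### the master inequality `S ≤ C₀ 𝔐^{3/4} (κ₀ 𝔐 + κ₁ S + c₁ S^{2/3})^{3/4}`
  set X : ℝ≥0∞ := κ₀ * 𝔐 + κ₁ * S + c₁ * S ^ (2 / 3 : ℝ) with hX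
  have hXt : X ≠ ⊤ := ENNReal.add_ne_top.2 ⟨ENNReal.add_ne_top.2 ⟨ENNReal.mul_ne_top hκ₀t h𝔐t,
    ENNReal.mul_ne_top hκ₁t hSt⟩, ENNReal.mul_ne_top ENNReal.coe_ne_top
    (ENNReal.rpow_ne_top_of_nonneg (by norm_num) hSt)⟩
  have h𝔐32 : 𝔐 ^ (3 / 2 : ℝ) ≤ 𝔐 := rpow_three_halves_le_of_le_one h𝔐1
  have hmaster : S ≤ (C₀ : ℝ≥0∞) * 𝔐 ^ (3 / 4 : ℝ) * X ^ (3 / 4 : ℝ) := by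
    rw [hS]
    refine iSup_le fun r => iSup_le fun hr => iSup_le fun z => iSup_le fun hz => ?_
    have hle : parabolicCylinderOpens r z ≤ (Literature.Analysis.FluidPDE.slab
        (EuclideanSpace ℝ (Fin 3)) (Set.Iio (0 : ℝ)) isOpen_Iio) := by
      intro w hw
      have hw' : w ∈ parabolicCylinder r z := hw
      show w ∈ (((Literature.Analysis.FluidPDE.slab (EuclideanSpace ℝ (Fin 3)) (Set.Iio (0 : ℝ))
        isOpen_Iio) : TopologicalSpace.Opens (ℝ × EuclideanSpace ℝ (Fin 3))) :
        Set (ℝ × EuclideanSpace ℝ (Fin 3)))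
      rw [coe_slab]
      exact parabolicCylinder_subset_past hz hw'
    have hGr : HasWeakSpatialGradientOn (parabolicCylinderOpens r z) v G := hwg.mono hle
    have hEr := hE r hr z hz
    have hEfin : cknE r z G ≠ ⊤ := ne_top_of_le_ne_top (ENNReal.add_ne_top.2
      ⟨ENNReal.add_ne_top.2 ⟨ENNReal.mul_ne_top ENNReal.coe_ne_top
        (ENNReal.rpow_ne_top_of_nonneg (by norm_num) hSt), ENNReal.mul_ne_top hκ₁t hSt⟩,
        ENNReal.mul_ne_top ENNReal.coe_ne_top (ENNReal.mul_ne_top hK₂t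
          (ENNReal.rpow_ne_top_of_nonneg (by norm_num) h𝔐t))⟩) hEr
    have hAr := hA r hr z hz
    have hAfin : cknAEss r z v ≠ ⊤ := ne_top_of_le_ne_top h𝔐t hAr
    have hAE : cknAEss r z v + cknE r z G ≤ X := by
      calc cknAEss r z v + cknE r z G
          ≤ 𝔐 + (c₁ * S ^ (2 / 3 : ℝ) + κ₁ * S + c₃ * (K₂ * 𝔐 ^ (3 / 2 : ℝ))) := add_le_add hAr hEr
        _ ≤ 𝔐 + (c₁ * S ^ (2 / 3 : ℝ) + κ₁ * S + c₃ * (K₂ * 𝔐)) := by gcongr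
        _ = X := by rw [hX, hκ₀]; ring
    calc cknC r z v
        ≤ C₀ * cknAEss r z v ^ (3 / 4 : ℝ) * (cknAEss r z v + cknE r z G) ^ (3 / 4 : ℝ) :=
          hC₀ v G z r hr hGr hAfin hEfin
      _ ≤ C₀ * 𝔐 ^ (3 / 4 : ℝ) * X ^ (3 / 4 : ℝ) := by gcongr
  -- ### `S ≤ Λ 𝔐`
  have hSΛ : S ≤ Λ * 𝔐 := by
    by_cases hS𝔐 : S ≤ 𝔐
    · calc S ≤ 𝔐 := hS𝔐
        _ = 1 * 𝔐 := (one_mul _).symm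
        _ ≤ Λ * 𝔐 := mul_le_mul' h1Λ (le_refl 𝔐)
    push Not at hS𝔐
    have hS0 : S ≠ 0 := (lt_of_le_of_lt (by positivity) hS𝔐).ne'
    by_cases hS1 : S ≤ 1
    · -- `𝔐 < S ≤ 1`: the bracket is `≤ κ S^{2/3}`
      have h23 : S ≤ S ^ (2 / 3 : ℝ) := le_rpow_two_thirds_of_le_one hS1
      have hXle : X ≤ κ * S ^ (2 / 3 : ℝ) := by
        calc X = κ₀ * 𝔐 + κ₁ * S + c₁ * S ^ (2 / 3 : ℝ) := hX
          _ ≤ κ₀ * S ^ (2 / 3 : ℝ) + κ₁ * S ^ (2 / 3 : ℝ) + c₁ * S ^ (2 / 3 : ℝ) :=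
              add_le_add (add_le_add (mul_le_mul' le_rfl (hS𝔐.le.trans h23))
                (mul_le_mul' le_rfl h23)) le_rfl
          _ = κ * S ^ (2 / 3 : ℝ) := by rw [hκ]; ring
      have h1 : S ≤ B₁ * 𝔐 ^ (3 / 4 : ℝ) * S ^ (1 / 2 : ℝ) := by
        calc S ≤ (C₀ : ℝ≥0∞) * 𝔐 ^ (3 / 4 : ℝ) * X ^ (3 / 4 : ℝ) := hmaster
          _ ≤ (C₀ : ℝ≥0∞) * 𝔐 ^ (3 / 4 : ℝ) * (κ * S ^ (2 / 3 : ℝ)) ^ (3 / 4 : ℝ) := by gcongr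
          _ = B₁ * 𝔐 ^ (3 / 4 : ℝ) * S ^ (1 / 2 : ℝ) := by
              rw [ENNReal.mul_rpow_of_nonneg _ _ (by norm_num : (0 : ℝ) ≤ 3 / 4),
                rpow_two_thirds_rpow_three_quarters, hB₁]
              ring
      -- cancel `S^{1/2}`
      -- `S = S^{1/2} S^{1/2} = (S^{1/2})²` (as `FourierNS.rpow_half_mul_rpow_half`, `ENNReal.rpow_half_sq`)
      have ehalf : S ^ (1 / 2 : ℝ) * S ^ (1 / 2 : ℝ) = S := by
        rw [← ENNReal.rpow_add_of_nonneg _ _ (by norm_num) (by norm_num)]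
        norm_num
      have esq : (S ^ (1 / 2 : ℝ)) ^ 2 = S := by rw [pow_two, ehalf]
      have hh0 : S ^ (1 / 2 : ℝ) ≠ 0 := by
        intro h0
        exact hS0 (by rw [← ehalf, h0, mul_zero])
      have hht : S ^ (1 / 2 : ℝ) ≠ ⊤ := ENNReal.rpow_ne_top_of_nonneg (by norm_num) hSt
      have h2 : S ^ (1 / 2 : ℝ) ≤ B₁ * 𝔐 ^ (3 / 4 : ℝ) := by
        rw [← ENNReal.mul_le_mul_iff_left hh0 hht, ehalf]
        exact h1
      -- square
      have h3 : S ≤ B₁ ^ 2 * (𝔐 ^ (3 / 4 : ℝ)) ^ 2 := by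
        calc S = (S ^ (1 / 2 : ℝ)) ^ 2 := esq.symm
          _ ≤ (B₁ * 𝔐 ^ (3 / 4 : ℝ)) ^ 2 := by gcongr
          _ = B₁ ^ 2 * (𝔐 ^ (3 / 4 : ℝ)) ^ 2 := by rw [mul_pow]
      have h4 : (𝔐 ^ (3 / 4 : ℝ)) ^ 2 ≤ 𝔐 := by
        rw [← ENNReal.rpow_natCast, ← ENNReal.rpow_mul]
        conv_rhs => rw [← ENNReal.rpow_one 𝔐]
        exact ENNReal.rpow_le_rpow_of_exponent_ge h𝔐1 (by norm_num)
      calc S ≤ B₁ ^ 2 * (𝔐 ^ (3 / 4 : ℝ)) ^ 2 := h3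
        _ ≤ B₁ ^ 2 * 𝔐 := mul_le_mul' (le_refl _) h4
        _ ≤ Λ * 𝔐 := mul_le_mul' hBΛ (le_refl 𝔐)
    · -- `S > 1` is impossible
      exfalso
      push Not at hS1
      have h23 : S ^ (2 / 3 : ℝ) ≤ S := rpow_two_thirds_le_of_one_le hS1.le
      have hXle : X ≤ κ * S := by
        calc X = κ₀ * 𝔐 + κ₁ * S + c₁ * S ^ (2 / 3 : ℝ) := hX
          _ ≤ κ₀ * S + κ₁ * S + c₁ * S :=
              add_le_add (add_le_add (mul_le_mul' le_rfl hS𝔐.le) le_rfl) (mul_le_mul' le_rfl h23)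
          _ = κ * S := by rw [hκ]; ring
      have h1 : S ≤ B₁ * 𝔐 ^ (3 / 4 : ℝ) * S ^ (3 / 4 : ℝ) := by
        calc S ≤ (C₀ : ℝ≥0∞) * 𝔐 ^ (3 / 4 : ℝ) * X ^ (3 / 4 : ℝ) := hmaster
          _ ≤ (C₀ : ℝ≥0∞) * 𝔐 ^ (3 / 4 : ℝ) * (κ * S) ^ (3 / 4 : ℝ) := by gcongr
          _ = B₁ * 𝔐 ^ (3 / 4 : ℝ) * S ^ (3 / 4 : ℝ) := by
              rw [ENNReal.mul_rpow_of_nonneg _ _ (by norm_num : (0 : ℝ) ≤ 3 / 4), hB₁]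
              ring
      -- cancel `S^{3/4}`
      have hh0 : S ^ (3 / 4 : ℝ) ≠ 0 := by
        intro h0
        exact hS0 (by rw [← rpow_quarter_mul_rpow_three_quarters S, h0, mul_zero])
      have hht : S ^ (3 / 4 : ℝ) ≠ ⊤ := ENNReal.rpow_ne_top_of_nonneg (by norm_num) hSt
      have h2 : S ^ (1 / 4 : ℝ) ≤ B₁ * 𝔐 ^ (3 / 4 : ℝ) := by
        rw [← ENNReal.mul_le_mul_iff_left hh0 hht, rpow_quarter_mul_rpow_three_quarters]
        exact h1
      -- fourth power: `S ≤ B₁⁴ 𝔐³ ≤ Γ 𝔐 ≤ Γ (2Γ)⁻¹ < 1`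
      have h3 : S ≤ B₁ ^ 4 * (𝔐 ^ (3 / 4 : ℝ)) ^ 4 := by
        calc S = (S ^ (1 / 4 : ℝ)) ^ 4 := (rpow_quarter_pow_four S).symm
          _ ≤ (B₁ * 𝔐 ^ (3 / 4 : ℝ)) ^ 4 := by gcongr
          _ = B₁ ^ 4 * (𝔐 ^ (3 / 4 : ℝ)) ^ 4 := by rw [mul_pow]
      have h4 : (𝔐 ^ (3 / 4 : ℝ)) ^ 4 ≤ 𝔐 := by
        rw [← ENNReal.rpow_natCast, ← ENNReal.rpow_mul]
        conv_rhs => rw [← ENNReal.rpow_one 𝔐]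
        exact ENNReal.rpow_le_rpow_of_exponent_ge h𝔐1 (by norm_num)
      have h5 : S ≤ Γ * (2 * Γ)⁻¹ := by
        calc S ≤ B₁ ^ 4 * (𝔐 ^ (3 / 4 : ℝ)) ^ 4 := h3
          _ ≤ B₁ ^ 4 * 𝔐 := mul_le_mul' (le_refl _) h4
          _ ≤ Γ * 𝔐 := mul_le_mul' hBΓ (le_refl 𝔐)
          _ ≤ Γ * (2 * Γ)⁻¹ := mul_le_mul' (le_refl Γ) (h𝔐τ.trans hτΓ)
      have h6 : Γ * (2 * Γ)⁻¹ = 2⁻¹ := by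
        rw [ENNReal.mul_inv (Or.inl two_ne_zero) (Or.inl ENNReal.ofNat_ne_top), ← mul_assoc,
          mul_comm Γ, mul_assoc, ENNReal.mul_inv_cancel hΓ0 hΓt, mul_one]
      rw [h6] at h5
      have : (1 : ℝ≥0∞) < 2⁻¹ := hS1.trans_le h5
      exact absurd this (not_lt.2 (ENNReal.inv_le_one.2 one_le_two))
  -- ### conclusion
  intro r hr z hz
  have h𝔐Λ : Λ * 𝔐 ≤ ε := by
    calc Λ * 𝔐 ≤ Λ * (ε / Λ) := mul_le_mul' (le_refl Λ) (h𝔐τ.trans hτΛ)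
      _ = ε := ENNReal.mul_div_cancel hΛ0 hΛt
  refine ⟨(hCS r hr z hz).trans (hSΛ.trans h𝔐Λ), ?_⟩
  have hr2 : 0 < r / 2 := by positivity
  have hD' := hD (r / 2) hr2 z hz
  rw [show 2 * (r / 2) = r by ring] at hD'
  calc cknDOsc r z P ≤ KD₁ * S + K₂ * 𝔐 ^ (3 / 2 : ℝ) := hD'
    _ ≤ KD₁ * (Λ * 𝔐) + K₂ * 𝔐 := add_le_add (mul_le_mul' (le_refl _) hSΛ) (mul_le_mul' (le_refl _) h𝔐32)
    _ = (KD₁ * Λ + K₂) * 𝔐 := by ring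
    _ ≤ Θ * 𝔐 := mul_le_mul' hΘle (le_refl 𝔐)
    _ ≤ Θ * (ε / Θ) := mul_le_mul' (le_refl Θ) (h𝔐τ.trans hτΘ)
    _ = ε := ENNReal.mul_div_cancel hΘ0 hΘt

/-- **Registered sub-goal `cknC_cknDOsc_small_of_morrey` of the open stub `stub_liouvilleMorrey`**
(crux stmt-NavierStokesRegularity-10579, line `registered`; = `small_cknC_cknDOsc_of_morrey`, stated
without local notation): uniform smallness of `C` and of the mean-free `D` on every past ball in
the small-Morrey regime. [cite: AlbrittonBarker2019, Lemma 2.6; GustafsonKangTsai2007, Thm 1.1] -/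
theorem cknC_cknDOsc_small_of_morrey : ∀ ε : ENNReal, 0 < ε → ∃ M₀ : ℝ, 0 < M₀ ∧ ∀ (v : ℝ →
    EuclideanSpace ℝ (Fin 3) → EuclideanSpace ℝ (Fin 3)) (P : ℝ → EuclideanSpace ℝ (Fin 3) → ℝ)
    (M V : ℝ), 0 ≤ M → M ≤ M₀ → 0 ≤ V → Literature.Analysis.FluidPDE.IsClassicalNSSolutionOn
    (Set.Iio 0) 1 0 v P → (∀ t < 0, ∀ (y : EuclideanSpace ℝ (Fin 3)) (r : ℝ), 0 < r → ∫ x in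
    Metric.ball y r, ‖v t x‖ ^ 2 ≤ M * r) → (∀ t < 0, ∀ x, ‖v t x‖ ≤ V) → ∀ (r : ℝ), 0 < r → ∀ z :
    ℝ × EuclideanSpace ℝ (Fin 3), z.1 ≤ 0 → Literature.Analysis.FluidPDE.cknC r z v ≤ ε ∧
    Literature.Analysis.FluidPDE.cknDOsc r z P ≤ ε :=
  small_cknC_cknDOsc_of_morrey

end Summit.NavierStokesRegularity.NavierStokesRegularity.Theorems.BoundedEnvelope

end
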